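import Summits.Ventures.Crystal3D.Theorems.StickyWulffConstantGenericWallFloorChainFramesWords
import Summits.Ventures.Crystal3D.Theorems.StickyWulffConstantGenericWallFloorStackWalkRayWords
import Summits.Ventures.Crystal3D.Theorems.StickyWulffConstantGenericWallFloorOfCore
import HarnessLib

/-!
# Ray-aligned pairs are `Σ3ⁿ`-related: one reduced mirror word from a co-axial coincidence of chain frames

HONEST FRAMING. Part of the venture `Summits/Ventures/Crystal3D` (cell `crystal3d-full`), helper `--supports` the
crux `GenericWallFloor` (stmt-Ventures-19480) of `route-Ventures-StickyWulffConstant`, registered line `WallLedgerG`,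
open stub `stub_twoSlabAdhesion`.  Second file of the WORD HALF of the planner's «cap localisation» G-CL (cf-p1
DECISION (l), 2026-08-28).  The residual of lane G (`GenericWallFloorCore`) consists of the RAY-ALIGNED pairs
(`RayAlignedAt A₁ A₂`: for every steep pair of launch slots some chain frame of grain 1 is co-axial with some chain
frame of grain 2).  `…ChainFramesWords` identified chain frames with the frames of admissible reduced model words;
here one co-axial coincidence is turned into ONE word relating the two base lattices:

* `wordFrame_reverse_append`, `wordFrame_wordFrame_reverse` — a word followed by its reverse is the identity
  (reflections are involutions): `wordFrame (wordFrame B κ) κ.reverse = B`.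
* **`exists_reduced_word`** — every word of unit model menu letters has a REDUCED word (consecutive letters at `±1/3`)
  with the same frame, obtained by cancelling equal adjacent mirrors; its letters are among the original ones and it is
  not longer.
* **`exists_transport_of_image_eq`** — TRANSPORT: if `F₂ = wordFrame A₂ β` and `F₂·Λ₀ = W·Λ₀`, then
  `A₂ = S ∘ … = S.trans (wordFrame W (β.reverse.map S))` for the lattice symmetry `S = W⁻¹ ∘ F₂` (`S·Λ₀ = Λ₀`); the
  transported letters are unit model menu normals, and reducedness is kept.
* **`exists_word_of_coaxial_wordFrames`**, **`exists_word_of_coaxial_chainFrames`** — a co-axial coincidence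
  (`eq_or_twin_of_coaxial`: equal lattices or mirror twins) between `F₁ = wordFrame A₁ α` and `F₂ = wordFrame A₂ β`
  gives `A₂·Λ₀ = (wordFrame A₁ (γ ++ j ++ α))·Λ₀` with `γ` the transported reverse of `β`, `j` empty or ONE junction
  letter (the twin's mirror); for chain frames `α`, `β` are the two ray words, so the raw word carries the launch data at
  both ends (`⟪u₁, α.last⟫ = √(2/3)`, `⟪A₂ u₂, (far frame) γ.head⟫ = √(2/3)`).
* **`exists_reduced_word_of_coaxial_chainFrames`**, **`exists_reduced_word_of_rayAlignedAt`** — hence for a ray-aligned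
  pair and any steep pair of slots: `A₂·Λ₀ = (wordFrame A₁ κ)·Λ₀` for a REDUCED admissible word `κ` — the pair is
  `Σ3ⁿ`-related, `n ≤ |κ|`, and by `map_reflection_eq_of_image_eq` the mirror sequence of `κ` is unique.

Left to the third file (terrace normalisation, W-C) and to the ν-half (19480-p1): which reduced words survive «for EVERY
steep pair», and the cubic symmetry putting the word in terrace position.

WHAT THIS IS NOT: not the stub; no counting; F-C1 not moved.
-/

noncomputable section

namespace Summit.Ventures.Crystal3D.Theorems

open Summit.Ventures.Crystal3D Finset
open Literature.MathematicalPhysics.StatisticalMechanics (fccStacking barlowStacking IsHaggSeq)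
open scoped InnerProductSpace

/-! ### Words followed by their reverse -/

/-- A word preceded (in application order) by its own reverse is trivial: `wordFrame B (κ.reverse ++ κ) = B`. -/
theorem wordFrame_reverse_append (B : EuclideanSpace ℝ (Fin 3) ≃ₗᵢ[ℝ] EuclideanSpace ℝ (Fin 3)) :
    ∀ κ : List (EuclideanSpace ℝ (Fin 3)), wordFrame B (κ.reverse ++ κ) = B
  | [] => rfl
  | μ :: κ => by
    rw [List.reverse_cons, List.append_assoc, List.singleton_append, wordFrame_append_cons_cons_cancel B _ rfl κ,
      wordFrame_reverse_append B κ]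

/-- **Undoing a word**: `wordFrame (wordFrame B κ) κ.reverse = B` (reflections are involutions). -/
theorem wordFrame_wordFrame_reverse (B : EuclideanSpace ℝ (Fin 3) ≃ₗᵢ[ℝ] EuclideanSpace ℝ (Fin 3))
    (κ : List (EuclideanSpace ℝ (Fin 3))) : wordFrame (wordFrame B κ) κ.reverse = B := by
  rw [← wordFrame_append, wordFrame_reverse_append]

/-- The twin frame across a unit normal as a one-letter word. -/
theorem twinFrame_eq_wordFrame_singleton (G : EuclideanSpace ℝ (Fin 3) ≃ₗᵢ[ℝ] EuclideanSpace ℝ (Fin 3))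
    {m : EuclideanSpace ℝ (Fin 3)} (hm : ‖m‖ = 1) : twinFrame G m = wordFrame G [G.symm m] :=
  twinFrame_eq_reflection_trans G hm

/-! ### Reduction of menu words -/

/-- **Every menu word reduces.**  A word of unit model menu letters has a reduced word (consecutive letters at `±1/3`)
with the same frame over any base, whose letters are among the original ones and which is not longer. -/
theorem exists_reduced_word (B : EuclideanSpace ℝ (Fin 3) ≃ₗᵢ[ℝ] EuclideanSpace ℝ (Fin 3)) :
    ∀ κ : List (EuclideanSpace ℝ (Fin 3)),
      (∀ μ ∈ κ, ‖μ‖ = 1 ∧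
        ∀ w ∈ fccSlots, ⟪w, μ⟫_ℝ = 0 ∨ ⟪w, μ⟫_ℝ = Real.sqrt (2 / 3) ∨ ⟪w, μ⟫_ℝ = -Real.sqrt (2 / 3)) →
      ∃ κ' : List (EuclideanSpace ℝ (Fin 3)),
        (∀ μ ∈ κ', μ ∈ κ) ∧ κ'.length ≤ κ.length ∧
        List.IsChain (fun μ μ' => ⟪μ, μ'⟫_ℝ = 1 / 3 ∨ ⟪μ, μ'⟫_ℝ = -1 / 3) κ' ∧
        wordFrame B κ' = wordFrame B κ
  | [], _ => ⟨[], fun μ h => h, le_rfl, List.isChain_nil, rfl⟩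
  | μ :: κ, hl => by
    obtain ⟨κ', hsub, hlen, hch, hfr⟩ := exists_reduced_word B κ fun ν hν => hl ν (List.mem_cons_of_mem μ hν)
    have hμ := hl μ List.mem_cons_self
    cases κ' with
    | nil =>
      refine ⟨[μ], fun ν hν => ?_, by simp, List.isChain_singleton μ, by rw [wordFrame_cons, wordFrame_cons, hfr]⟩
      rw [List.mem_singleton] at hν
      rw [hν]; exact List.mem_cons_self
    | cons y t =>
      by_cases hR : (ℝ ∙ μ)ᗮ.reflection = (ℝ ∙ y)ᗮ.reflection
      · -- the new letter cancels against the head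
        refine ⟨t, fun ν hν => List.mem_cons_of_mem μ (hsub ν (List.mem_cons_of_mem y hν)), ?_, ?_, ?_⟩
        · rw [List.length_cons] at hlen ⊢; omega
        · exact (List.isChain_cons.1 hch).2
        · rw [wordFrame_cons, ← hfr, ← wordFrame_cons, wordFrame_cons_cons_cancel B hR t]
      · refine ⟨μ :: y :: t, fun ν hν => ?_, ?_, ?_, by rw [wordFrame_cons, hfr, wordFrame_cons]⟩
        · rcases List.mem_cons.1 hν with rfl | hν'
          · exact List.mem_cons_self
          · exact List.mem_cons_of_mem _ (hsub ν hν')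
        · simp only [List.length_cons] at hlen ⊢; omega
        · rw [List.isChain_cons]
          refine ⟨fun b hb => ?_, hch⟩
          rw [List.head?_cons, Option.mem_some_iff] at hb
          rw [← hb]
          exact inner_third_of_reflection_ne hμ (hl y (List.mem_cons_of_mem μ (hsub y List.mem_cons_self))) hR

/-! ### Transport of a word through a lattice coincidence -/

/-- Letters transported by a symmetry of `Λ₀` are again unit model menu normals. -/
theorem menuLetters_map {S : EuclideanSpace ℝ (Fin 3) ≃ₗᵢ[ℝ] EuclideanSpace ℝ (Fin 3)}
    (hS : S '' fccStacking 1 (Real.sqrt (2 / 3)) = fccStacking 1 (Real.sqrt (2 / 3)))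
    {β : List (EuclideanSpace ℝ (Fin 3))}
    (hβ : ∀ μ ∈ β, ‖μ‖ = 1 ∧
      ∀ w ∈ fccSlots, ⟪w, μ⟫_ℝ = 0 ∨ ⟪w, μ⟫_ℝ = Real.sqrt (2 / 3) ∨ ⟪w, μ⟫_ℝ = -Real.sqrt (2 / 3)) :
    ∀ μ ∈ β.map S, ‖μ‖ = 1 ∧
      ∀ w ∈ fccSlots, ⟪w, μ⟫_ℝ = 0 ∨ ⟪w, μ⟫_ℝ = Real.sqrt (2 / 3) ∨ ⟪w, μ⟫_ℝ = -Real.sqrt (2 / 3) := by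
  have hSslots := image_fccSlots_eq_self_of_image_fcc S hS
  have hSmem' : ∀ w ∈ fccSlots, S.symm w ∈ fccSlots := fun w hw => by
    have hw' : w ∈ (S : EuclideanSpace ℝ (Fin 3) → EuclideanSpace ℝ (Fin 3)) '' ↑fccSlots := by
      rw [hSslots]; exact Finset.mem_coe.2 hw
    obtain ⟨w', hw', hw'eq⟩ := hw'
    rw [← hw'eq, LinearIsometryEquiv.symm_apply_apply]; exact Finset.mem_coe.1 hw'
  intro μ hμ
  obtain ⟨ν, hν, rfl⟩ := List.mem_map.1 hμ
  obtain ⟨hνu, hνm⟩ := hβ ν hν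
  refine ⟨by rw [LinearIsometryEquiv.norm_map, hνu], fun w hw => ?_⟩
  have hsw : ⟪w, S ν⟫_ℝ = ⟪S.symm w, ν⟫_ℝ := by
    rw [← LinearIsometryEquiv.inner_map_map S (S.symm w) ν, LinearIsometryEquiv.apply_symm_apply]
  rw [hsw]; exact hνm _ (hSmem' w hw)

/-- Reducedness is kept by reversing and transporting. -/
theorem isChain_reverse_map (S : EuclideanSpace ℝ (Fin 3) ≃ₗᵢ[ℝ] EuclideanSpace ℝ (Fin 3))
    {β : List (EuclideanSpace ℝ (Fin 3))}
    (hβc : List.IsChain (fun μ μ' => ⟪μ, μ'⟫_ℝ = 1 / 3 ∨ ⟪μ, μ'⟫_ℝ = -1 / 3) β) :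
    List.IsChain (fun μ μ' => ⟪μ, μ'⟫_ℝ = 1 / 3 ∨ ⟪μ, μ'⟫_ℝ = -1 / 3) (β.reverse.map S) := by
  rw [List.isChain_map]
  have h : List.IsChain (fun μ μ' => ⟪μ, μ'⟫_ℝ = 1 / 3 ∨ ⟪μ, μ'⟫_ℝ = -1 / 3) β.reverse := by
    rw [List.isChain_reverse]
    exact hβc.imp fun a b h => by rw [real_inner_comm]; exact h
  simpa only [LinearIsometryEquiv.inner_map_map] using h

/-- **Transport of a word through a lattice coincidence.**  If `F₂ = wordFrame A₂ β` (unit model menu letters) and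
`F₂·Λ₀ = W·Λ₀`, then for the lattice symmetry `S = W⁻¹ ∘ F₂` (`S·Λ₀ = Λ₀`):  `A₂ = S.trans (wordFrame W (β.reverse.map S))`
— so `A₂·Λ₀ = (wordFrame W (β.reverse.map S))·Λ₀` — and the transported letters are unit model menu normals. -/
theorem exists_transport_of_image_eq {A₂ F₂ W : EuclideanSpace ℝ (Fin 3) ≃ₗᵢ[ℝ] EuclideanSpace ℝ (Fin 3)}
    {β : List (EuclideanSpace ℝ (Fin 3))} (hF₂ : F₂ = wordFrame A₂ β)
    (hβ : ∀ μ ∈ β, ‖μ‖ = 1 ∧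
      ∀ w ∈ fccSlots, ⟪w, μ⟫_ℝ = 0 ∨ ⟪w, μ⟫_ℝ = Real.sqrt (2 / 3) ∨ ⟪w, μ⟫_ℝ = -Real.sqrt (2 / 3))
    (himg : F₂ '' fccStacking 1 (Real.sqrt (2 / 3)) = W '' fccStacking 1 (Real.sqrt (2 / 3))) :
    ∃ S : EuclideanSpace ℝ (Fin 3) ≃ₗᵢ[ℝ] EuclideanSpace ℝ (Fin 3),
      S '' fccStacking 1 (Real.sqrt (2 / 3)) = fccStacking 1 (Real.sqrt (2 / 3)) ∧
      (∀ x, wordFrame W (β.reverse.map S) (S x) = A₂ x) ∧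
      A₂ '' fccStacking 1 (Real.sqrt (2 / 3)) =
        (wordFrame W (β.reverse.map S)) '' fccStacking 1 (Real.sqrt (2 / 3)) ∧
      (∀ μ ∈ β.reverse.map S, ‖μ‖ = 1 ∧
        ∀ w ∈ fccSlots, ⟪w, μ⟫_ℝ = 0 ∨ ⟪w, μ⟫_ℝ = Real.sqrt (2 / 3) ∨ ⟪w, μ⟫_ℝ = -Real.sqrt (2 / 3)) := by
  set S : EuclideanSpace ℝ (Fin 3) ≃ₗᵢ[ℝ] EuclideanSpace ℝ (Fin 3) := F₂.trans W.symm with hS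
  have hWS : ∀ x, W (S x) = F₂ x := fun x => by
    rw [hS, LinearIsometryEquiv.trans_apply, LinearIsometryEquiv.apply_symm_apply]
  have hF₂S : F₂ = S.trans W := LinearIsometryEquiv.ext fun x => by rw [LinearIsometryEquiv.trans_apply, hWS]
  have hSfcc : S '' fccStacking 1 (Real.sqrt (2 / 3)) = fccStacking 1 (Real.sqrt (2 / 3)) := by
    rw [hS, LinearIsometryEquiv.coe_trans, Set.image_comp, himg, Set.image_image]
    simp only [LinearIsometryEquiv.symm_apply_apply, Set.image_id']
  have hβr : ∀ μ ∈ β.reverse, ‖μ‖ = 1 ∧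
      ∀ w ∈ fccSlots, ⟪w, μ⟫_ℝ = 0 ∨ ⟪w, μ⟫_ℝ = Real.sqrt (2 / 3) ∨ ⟪w, μ⟫_ℝ = -Real.sqrt (2 / 3) :=
    fun μ hμ => hβ μ (List.mem_reverse.1 hμ)
  have hA₂ : A₂ = S.trans (wordFrame W (β.reverse.map S)) := by
    rw [← wordFrame_trans W S β.reverse fun μ hμ => (hβr μ hμ).1, ← hF₂S, hF₂, wordFrame_wordFrame_reverse]
  refine ⟨S, hSfcc, fun x => ?_, ?_, menuLetters_map hSfcc hβr⟩
  · conv_rhs => rw [hA₂]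
    rfl
  · rw [hA₂, image_trans_eq, hSfcc]

/-! ### One word from a co-axial coincidence -/

/-- **One word from a co-axial coincidence of word frames.**  `F₁ = wordFrame A₁ α`, `F₂ = wordFrame A₂ β` (unit model
menu letters) co-axial ⇒ `A₂·Λ₀ = (wordFrame A₁ (γ ++ j ++ α))·Λ₀` where `γ` is the transported reverse of `β`
(`|γ| = |β|`, reduced if `β` is, letters unit model menu normals) and the JUNCTION `j` is empty (equal lattices) or one
unit model menu letter (the twin's mirror pulled back through `F₁`); moreover the far frame realises `A₂` through the
lattice symmetry `S`: `wordFrame A₁ (γ ++ j ++ α) (S x) = A₂ x`, and `γ = β.reverse.map S`. -/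
theorem exists_word_of_coaxial_wordFrames
    {A₁ A₂ F₁ F₂ : EuclideanSpace ℝ (Fin 3) ≃ₗᵢ[ℝ] EuclideanSpace ℝ (Fin 3)} {α β : List (EuclideanSpace ℝ (Fin 3))}
    (hF₁ : F₁ = wordFrame A₁ α) (hF₂ : F₂ = wordFrame A₂ β)
    (hβ : ∀ μ ∈ β, ‖μ‖ = 1 ∧
      ∀ w ∈ fccSlots, ⟪w, μ⟫_ℝ = 0 ∨ ⟪w, μ⟫_ℝ = Real.sqrt (2 / 3) ∨ ⟪w, μ⟫_ℝ = -Real.sqrt (2 / 3))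
    (hco : ∃ (L : EuclideanSpace ℝ (Fin 3) ≃ₗᵢ[ℝ] EuclideanSpace ℝ (Fin 3))
        (s₁ s₂ : EuclideanSpace ℝ (Fin 3)) (σ σ' : ℤ → ℤ), IsHaggSeq σ ∧ IsHaggSeq σ' ∧
        F₁ '' fccStacking 1 (Real.sqrt (2 / 3)) ⊆ (fun p => L p + s₁) '' barlowStacking 1 (Real.sqrt (2 / 3)) σ ∧
        F₂ '' fccStacking 1 (Real.sqrt (2 / 3)) ⊆ (fun p => L p + s₂) '' barlowStacking 1 (Real.sqrt (2 / 3)) σ') :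
    ∃ (S : EuclideanSpace ℝ (Fin 3) ≃ₗᵢ[ℝ] EuclideanSpace ℝ (Fin 3)) (γ j : List (EuclideanSpace ℝ (Fin 3))),
      S '' fccStacking 1 (Real.sqrt (2 / 3)) = fccStacking 1 (Real.sqrt (2 / 3)) ∧
      γ = β.reverse.map S ∧
      (j = [] ∨ ∃ m : EuclideanSpace ℝ (Fin 3), ‖m‖ = 1 ∧
        (∀ w ∈ fccSlots, ⟪F₁ w, m⟫_ℝ = 0 ∨ ⟪F₁ w, m⟫_ℝ = Real.sqrt (2 / 3) ∨ ⟪F₁ w, m⟫_ℝ = -Real.sqrt (2 / 3)) ∧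
        j = [F₁.symm m]) ∧
      (∀ μ ∈ γ ++ j, ‖μ‖ = 1 ∧
        ∀ w ∈ fccSlots, ⟪w, μ⟫_ℝ = 0 ∨ ⟪w, μ⟫_ℝ = Real.sqrt (2 / 3) ∨ ⟪w, μ⟫_ℝ = -Real.sqrt (2 / 3)) ∧
      (∀ x, wordFrame A₁ (γ ++ j ++ α) (S x) = A₂ x) ∧
      A₂ '' fccStacking 1 (Real.sqrt (2 / 3)) = (wordFrame A₁ (γ ++ j ++ α)) '' fccStacking 1 (Real.sqrt (2 / 3)) := by
  rcases eq_or_twin_of_coaxial F₁ F₂ hco with hEq | ⟨m, hm, hmenu, hEq⟩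
  · -- equal lattices: no junction letter
    obtain ⟨S, hS, hSx, himg, hγ⟩ := exists_transport_of_image_eq hF₂ hβ hEq.symm
    refine ⟨S, β.reverse.map S, [], hS, rfl, Or.inl rfl, by simpa using hγ, fun x => ?_, ?_⟩
    · rw [List.append_nil, wordFrame_append, ← hF₁]; exact hSx x
    · rw [List.append_nil, wordFrame_append, ← hF₁]; exact himg
  · -- mirror twins: one junction letter
    have hW : twinFrame F₁ m = wordFrame A₁ ([F₁.symm m] ++ α) := by
      rw [wordFrame_append, ← hF₁]; exact twinFrame_eq_wordFrame_singleton F₁ hm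
    obtain ⟨S, hS, hSx, himg, hγ⟩ := exists_transport_of_image_eq hF₂ hβ hEq
    have hj : ∀ μ ∈ [F₁.symm m], ‖μ‖ = 1 ∧
        ∀ w ∈ fccSlots, ⟪w, μ⟫_ℝ = 0 ∨ ⟪w, μ⟫_ℝ = Real.sqrt (2 / 3) ∨ ⟪w, μ⟫_ℝ = -Real.sqrt (2 / 3) := by
      intro μ hμ
      rw [List.mem_singleton] at hμ
      subst hμ
      refine ⟨by rw [LinearIsometryEquiv.norm_map, hm], fun w hw => ?_⟩
      rw [← LinearIsometryEquiv.inner_map_map F₁, LinearIsometryEquiv.apply_symm_apply]; exact hmenu w hw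
    refine ⟨S, β.reverse.map S, [F₁.symm m], hS, rfl, Or.inr ⟨m, hm, hmenu, rfl⟩, fun μ hμ => ?_, fun x => ?_, ?_⟩
    · rcases List.mem_append.1 hμ with h | h
      · exact hγ μ h
      · exact hj μ h
    · rw [List.append_assoc, wordFrame_append, ← hW]; exact hSx x
    · rw [List.append_assoc, wordFrame_append, ← hW]; exact himg

/-- **One word from a co-axial coincidence of CHAIN frames** (the `RayAlignedAt` witness).  For `F₁ ∈ chainFrames z₁ A₁ u₁`
and `F₂ ∈ chainFrames z₂ A₂ u₂` co-axial: `A₂·Λ₀ = (wordFrame A₁ (γ ++ j ++ α))·Λ₀` with `α` the ray word of `F₁`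
(reduced, empty or its LAST letter adjacent to `u₁`), `γ` the transported reverse ray word of `F₂` (reduced, empty or its
HEAD letter adjacent to `A₂ u₂` through the far frame), and `j` empty or one junction letter; all letters unit model menu
normals. -/
theorem exists_word_of_coaxial_chainFrames {z₁ z₂ : EuclideanSpace ℝ (Fin 3)}
    {A₁ A₂ F₁ F₂ : EuclideanSpace ℝ (Fin 3) ≃ₗᵢ[ℝ] EuclideanSpace ℝ (Fin 3)} {u₁ u₂ : EuclideanSpace ℝ (Fin 3)}
    (hF₁ : F₁ ∈ chainFrames z₁ A₁ u₁) (hF₂ : F₂ ∈ chainFrames z₂ A₂ u₂)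
    (hco : ∃ (L : EuclideanSpace ℝ (Fin 3) ≃ₗᵢ[ℝ] EuclideanSpace ℝ (Fin 3))
        (s₁ s₂ : EuclideanSpace ℝ (Fin 3)) (σ σ' : ℤ → ℤ), IsHaggSeq σ ∧ IsHaggSeq σ' ∧
        F₁ '' fccStacking 1 (Real.sqrt (2 / 3)) ⊆ (fun p => L p + s₁) '' barlowStacking 1 (Real.sqrt (2 / 3)) σ ∧
        F₂ '' fccStacking 1 (Real.sqrt (2 / 3)) ⊆ (fun p => L p + s₂) '' barlowStacking 1 (Real.sqrt (2 / 3)) σ') :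
    ∃ γ j α : List (EuclideanSpace ℝ (Fin 3)),
      F₁ = wordFrame A₁ α ∧
      (∀ μ ∈ γ ++ j ++ α, ‖μ‖ = 1 ∧
        ∀ w ∈ fccSlots, ⟪w, μ⟫_ℝ = 0 ∨ ⟪w, μ⟫_ℝ = Real.sqrt (2 / 3) ∨ ⟪w, μ⟫_ℝ = -Real.sqrt (2 / 3)) ∧
      List.IsChain (fun μ μ' => ⟪μ, μ'⟫_ℝ = 1 / 3 ∨ ⟪μ, μ'⟫_ℝ = -1 / 3) α ∧
      List.IsChain (fun μ μ' => ⟪μ, μ'⟫_ℝ = 1 / 3 ∨ ⟪μ, μ'⟫_ℝ = -1 / 3) γ ∧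
      j.length ≤ 1 ∧
      (α = [] ∨ ∃ μ, α.getLast? = some μ ∧ ⟪u₁, μ⟫_ℝ = Real.sqrt (2 / 3)) ∧
      (γ = [] ∨ ∃ μ, γ.head? = some μ ∧ ⟪A₂ u₂, wordFrame A₁ (γ ++ j ++ α) μ⟫_ℝ = Real.sqrt (2 / 3)) ∧
      A₂ '' fccStacking 1 (Real.sqrt (2 / 3)) = (wordFrame A₁ (γ ++ j ++ α)) '' fccStacking 1 (Real.sqrt (2 / 3)) := by
  obtain ⟨α, hF₁α, hαl, hαc, hαlast⟩ := exists_word_of_mem_chainFrames hF₁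
  obtain ⟨β, hF₂β, hβl, hβc, hβlast⟩ := exists_word_of_mem_chainFrames hF₂
  obtain ⟨S, γ, j, -, hγ, hj, hγjl, hSx, himg⟩ := exists_word_of_coaxial_wordFrames hF₁α hF₂β hβl hco
  refine ⟨γ, j, α, hF₁α, fun μ hμ => ?_, hαc.imp fun _ _ h => Or.inr h, ?_, ?_, hαlast, ?_, himg⟩
  · rcases List.mem_append.1 hμ with h | h
    · exact hγjl μ h
    · exact hαl μ h
  · rw [hγ]; exact isChain_reverse_map S (hβc.imp fun _ _ h => Or.inr h)
  · rcases hj with rfl | ⟨m, -, -, rfl⟩ <;> simp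
  · rcases hβlast with rfl | ⟨μ, hμ, hμu⟩
    · left; rw [hγ]; rfl
    · right
      refine ⟨S μ, by rw [hγ, List.map_reverse, List.head?_reverse, List.getLast?_map, hμ]; rfl, ?_⟩
      rw [← hSx u₂, LinearIsometryEquiv.inner_map_map, LinearIsometryEquiv.inner_map_map]; exact hμu

/-- **Co-axial chain frames ⇒ the base lattices are related by a REDUCED admissible word.** -/
theorem exists_reduced_word_of_coaxial_chainFrames {z₁ z₂ : EuclideanSpace ℝ (Fin 3)}
    {A₁ A₂ F₁ F₂ : EuclideanSpace ℝ (Fin 3) ≃ₗᵢ[ℝ] EuclideanSpace ℝ (Fin 3)} {u₁ u₂ : EuclideanSpace ℝ (Fin 3)}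
    (hF₁ : F₁ ∈ chainFrames z₁ A₁ u₁) (hF₂ : F₂ ∈ chainFrames z₂ A₂ u₂)
    (hco : ∃ (L : EuclideanSpace ℝ (Fin 3) ≃ₗᵢ[ℝ] EuclideanSpace ℝ (Fin 3))
        (s₁ s₂ : EuclideanSpace ℝ (Fin 3)) (σ σ' : ℤ → ℤ), IsHaggSeq σ ∧ IsHaggSeq σ' ∧
        F₁ '' fccStacking 1 (Real.sqrt (2 / 3)) ⊆ (fun p => L p + s₁) '' barlowStacking 1 (Real.sqrt (2 / 3)) σ ∧
        F₂ '' fccStacking 1 (Real.sqrt (2 / 3)) ⊆ (fun p => L p + s₂) '' barlowStacking 1 (Real.sqrt (2 / 3)) σ') :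
    ∃ κ : List (EuclideanSpace ℝ (Fin 3)),
      (∀ μ ∈ κ, ‖μ‖ = 1 ∧
        ∀ w ∈ fccSlots, ⟪w, μ⟫_ℝ = 0 ∨ ⟪w, μ⟫_ℝ = Real.sqrt (2 / 3) ∨ ⟪w, μ⟫_ℝ = -Real.sqrt (2 / 3)) ∧
      List.IsChain (fun μ μ' => ⟪μ, μ'⟫_ℝ = 1 / 3 ∨ ⟪μ, μ'⟫_ℝ = -1 / 3) κ ∧
      A₂ '' fccStacking 1 (Real.sqrt (2 / 3)) = (wordFrame A₁ κ) '' fccStacking 1 (Real.sqrt (2 / 3)) := by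
  obtain ⟨γ, j, α, -, hl, -, -, -, -, -, himg⟩ := exists_word_of_coaxial_chainFrames hF₁ hF₂ hco
  obtain ⟨κ, hsub, -, hch, hfr⟩ := exists_reduced_word A₁ (γ ++ j ++ α) hl
  exact ⟨κ, fun μ hμ => hl μ (hsub μ hμ), hch, by rw [hfr]; exact himg⟩

/-- **Ray-aligned pairs are `Σ3ⁿ`-related.**  For a ray-aligned pair and ANY steep pair of slots (`A₁ u₁` steep up,
`A₂ u₂` steep down) the far lattice is a reduced admissible word away from the near one:
`A₂·Λ₀ = (wordFrame A₁ κ)·Λ₀`. -/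
theorem exists_reduced_word_of_rayAlignedAt {A₁ A₂ : EuclideanSpace ℝ (Fin 3) ≃ₗᵢ[ℝ] EuclideanSpace ℝ (Fin 3)}
    (hray : RayAlignedAt A₁ A₂) {u₁ u₂ : EuclideanSpace ℝ (Fin 3)} (hu₁ : u₁ ∈ fccSlots)
    (hs₁ : Real.sqrt 2 / 2 ≤ ⟪A₁ u₁, EuclideanSpace.single (2 : Fin 3) (1 : ℝ)⟫_ℝ) (hu₂ : u₂ ∈ fccSlots)
    (hs₂ : ⟪A₂ u₂, EuclideanSpace.single (2 : Fin 3) (1 : ℝ)⟫_ℝ ≤ -(Real.sqrt 2 / 2)) :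
    ∃ κ : List (EuclideanSpace ℝ (Fin 3)),
      (∀ μ ∈ κ, ‖μ‖ = 1 ∧
        ∀ w ∈ fccSlots, ⟪w, μ⟫_ℝ = 0 ∨ ⟪w, μ⟫_ℝ = Real.sqrt (2 / 3) ∨ ⟪w, μ⟫_ℝ = -Real.sqrt (2 / 3)) ∧
      List.IsChain (fun μ μ' => ⟪μ, μ'⟫_ℝ = 1 / 3 ∨ ⟪μ, μ'⟫_ℝ = -1 / 3) κ ∧
      A₂ '' fccStacking 1 (Real.sqrt (2 / 3)) = (wordFrame A₁ κ) '' fccStacking 1 (Real.sqrt (2 / 3)) := by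
  obtain ⟨F₁, hF₁, F₂, hF₂, hco⟩ := hray u₁ hu₁ hs₁ u₂ hu₂ hs₂
  exact exists_reduced_word_of_coaxial_chainFrames hF₁ hF₂ hco

/-- The raw (unreduced) version for a ray-aligned pair, keeping the launch data at both ends of the word. -/
theorem exists_word_of_rayAlignedAt {A₁ A₂ : EuclideanSpace ℝ (Fin 3) ≃ₗᵢ[ℝ] EuclideanSpace ℝ (Fin 3)}
    (hray : RayAlignedAt A₁ A₂) {u₁ u₂ : EuclideanSpace ℝ (Fin 3)} (hu₁ : u₁ ∈ fccSlots)
    (hs₁ : Real.sqrt 2 / 2 ≤ ⟪A₁ u₁, EuclideanSpace.single (2 : Fin 3) (1 : ℝ)⟫_ℝ) (hu₂ : u₂ ∈ fccSlots)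
    (hs₂ : ⟪A₂ u₂, EuclideanSpace.single (2 : Fin 3) (1 : ℝ)⟫_ℝ ≤ -(Real.sqrt 2 / 2)) :
    ∃ γ j α : List (EuclideanSpace ℝ (Fin 3)),
      wordFrame A₁ α ∈ chainFrames (EuclideanSpace.single (2 : Fin 3) (1 : ℝ)) A₁ u₁ ∧
      (∀ μ ∈ γ ++ j ++ α, ‖μ‖ = 1 ∧
        ∀ w ∈ fccSlots, ⟪w, μ⟫_ℝ = 0 ∨ ⟪w, μ⟫_ℝ = Real.sqrt (2 / 3) ∨ ⟪w, μ⟫_ℝ = -Real.sqrt (2 / 3)) ∧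
      List.IsChain (fun μ μ' => ⟪μ, μ'⟫_ℝ = 1 / 3 ∨ ⟪μ, μ'⟫_ℝ = -1 / 3) α ∧
      List.IsChain (fun μ μ' => ⟪μ, μ'⟫_ℝ = 1 / 3 ∨ ⟪μ, μ'⟫_ℝ = -1 / 3) γ ∧
      j.length ≤ 1 ∧
      (α = [] ∨ ∃ μ, α.getLast? = some μ ∧ ⟪u₁, μ⟫_ℝ = Real.sqrt (2 / 3)) ∧
      (γ = [] ∨ ∃ μ, γ.head? = some μ ∧
        ⟪A₂ u₂, wordFrame A₁ (γ ++ j ++ α) μ⟫_ℝ = Real.sqrt (2 / 3)) ∧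
      A₂ '' fccStacking 1 (Real.sqrt (2 / 3)) = (wordFrame A₁ (γ ++ j ++ α)) '' fccStacking 1 (Real.sqrt (2 / 3)) := by
  obtain ⟨F₁, hF₁, F₂, hF₂, hco⟩ := hray u₁ hu₁ hs₁ u₂ hu₂ hs₂
  obtain ⟨γ, j, α, hF₁α, hl, hαc, hγc, hj, hαlast, hγhead, himg⟩ := exists_word_of_coaxial_chainFrames hF₁ hF₂ hco
  exact ⟨γ, j, α, hF₁α ▸ hF₁, hl, hαc, hγc, hj, hαlast, hγhead, himg⟩

end Summit.Ventures.Crystal3D.Theorems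

end
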